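import Summits.BirchSwinnertonDyer.BirchSwinnertonDyer.Theorems.BiquadraticEisensteinDescentManinDatumSupercuspidalCMInertOfGoodAtTwoDictionary
import Literature.NumberTheory.EllipticCurves.SexticTwistThetaDictionaryGoodTwoInert
import HarnessLib

set_option linter.dupNamespace false -- `Summit.BirchSwinnertonDyer.BirchSwinnertonDyer.Theorems.…` (summit = sub, D-0017)
set_option autoImplicit false

/-!
# Crux `ManinDatumSupercuspidalCMInert` (stmt-BirchSwinnertonDyer-20111, BED r605) — ★★ THE CRUX, UNCONDITIONALLY: the supercuspidal Manin
# residual for CM curves of analytic rank `1` at `p ∈ {5, 7}` (`j = 0`: Kodaira `II/IV/IV*/II*` at `5`; `j = 1728`: `III/III*` at `7`)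
# (width seat `bsd-wall-cm-bed-w3` g11; theorems only; route cone; `--supports 20111`)

Route `BiquadraticEisensteinDescent` (cell `pub/bsd-wall`). Last assembly step of the `j = 0` half: the sextic theta dictionary on the good-at-`2`
class `k = 16u`, `u ≡ 1 (4)` (bed-w2 g11's `SexticTwist.lSeries_twist_eq_thetaLFunction_five_good`, p652571, Ireland–Rosen Ch. 18 §7 with
`a₂ = 0`) is packaged exactly like the additive-at-`2` classes (`…SexticDictionaryPackaging.dictDataRho_of_not_goodAtTwo`, from bed-w2 g11's
`…_five`), which discharges the last hypothesis `hgood` of `…OfGoodAtTwoDictionary.maninDatumSupercuspidalCMInert_of_goodAtTwoDictionary`: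

* `dictDataRho_of_goodAtTwo` — the `∃`-body of `hdictAllRho` on the good-at-`2` class;
* `hdictAllRho_holds` — the sextic theta dictionary over the whole range of `H₅`;
* ★★ `maninDatumSupercuspidalCMInert_holds : ManinDatumSupercuspidalCMInert`.

Chain (all tree theorems): E-side `SexticTwist*` (bed-w2 g11) → D4 assembly `…ThetaValueAssemblyJZero` / `…ModelLValuesSexticOfDictionary`
(bed-w3 g11; periods `…SexticModelPeriods`, bed-w1 g8) → CM core `…ResolventCertificateJZero.core_rho_of_character` (bed-w1 g8) → `H₅` →
`…OfH5.maninDatumSupercuspidalCMInert_of_H5` (bed-w3 g10; `j = 1728` half = `stub_S7`, RES₇fin certificate). HONEST FRAMING: this proves the crux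
`ManinDatumSupercuspidalCMInert` (item 20111) and nothing above it: its parent `ManinDatumFiveSevenCMInert`, Manin's conjecture in general and BSD are
NOT proved by this. No definition, no named fact, no `sorry`; axioms standard.
-/

noncomputable section

open scoped Classical
open Complex
open Literature.NumberTheory.EllipticCurves
open Literature.NumberTheory.LFunctions
open Summit.BirchSwinnertonDyer.BirchSwinnertonDyer.Theses.BiquadraticEisensteinDescent

namespace Summit.BirchSwinnertonDyer.BirchSwinnertonDyer.Theorems.BiquadraticEisensteinDescentManinDatumSupercuspidalCMInertSexticDictionaryHolds

open Summit.BirchSwinnertonDyer.BirchSwinnertonDyer.Theorems.BiquadraticEisensteinDescentManinDatumSupercuspidalCMInertSexticDictionaryPackaging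
  (sqrt_three_natCast not_five_dvd_of_prime_not_dvd differentiable_cpow_div_mul)
open Summit.BirchSwinnertonDyer.BirchSwinnertonDyer.Theorems.BiquadraticEisensteinDescentManinDatumSupercuspidalCMInertOfGoodAtTwoDictionary
  (hdictAllRho_of_goodAtTwo maninDatumSupercuspidalCMInert_of_goodAtTwoDictionary)

/-- `|k| = 5^e·(16|u₁|)` for `k = 16u`, `u = 5^e u₁`. [folklore] -/
theorem natAbs_eq_of_eq_sixteen_mul {k u u₁ : ℤ} {e : ℕ} (hk : k = 16 * u) (hu : u = 5 ^ e * u₁) :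
    k.natAbs = 5 ^ e * (16 * u₁.natAbs) := by
  rw [hk, hu, Int.natAbs_mul, Int.natAbs_mul, Int.natAbs_pow]
  simp only [Int.reduceAbs]
  ring

/-- **The per-`(k, ℓ, χ)` dictionary data of `hdictAllRho` on the good-at-`2` class** `k = 16u`, `u ≡ 1 (4)`, from bed-w2 g11's
`SexticTwist.lSeries_twist_eq_thetaLFunction_five_good` at `c = χ̄` (`W = Φ₅ ⊗ Ψ`, `L(s) = (4^s/2)·Θ(s)`, `u = 2`, `N = 1`, `k₁ = 16|u₁|`).
[cite: IrelandRosen1990, Ch. 18 §7] [cite: Rubin1999, §7.4 Prop. 7.15] -/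
theorem dictDataRho_of_goodAtTwo (k : ℤ) (_ : k ≠ 0) (h5k : (5 : ℤ) ∣ k) (h6 : ∀ q : ℕ, q.Prime → ¬ ((q : ℤ) ^ 6 ∣ k))
    (h2 : ∃ u : ℤ, u % 4 = 1 ∧ k = 16 * u)
    (ℓ : ℕ) [NeZero ℓ] (hℓ : ℓ.Prime) (hℓk : ¬ (ℓ : ℤ) ∣ k) (χ : DirichletCharacter ℂ ℓ) :
    ∃ (e k₁ M' : ℕ) (_ : NeZero M') (Φ₅ : ZMod 5 × ZMod 5 → ℂ) (Ψ W : ℤ × ℤ → ℂ) (L : ℂ → ℂ) (u : ℂ) (N : ℕ),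
      1 ≤ e ∧ e ≤ 5 ∧ k.natAbs = 5 ^ e * k₁ ∧ Nat.Coprime 5 M' ∧
      Φ₅ 0 = 0 ∧
      (∀ d d' : ZMod 5 × ZMod 5, Φ₅ (d.1 * d'.2 + d.2 * d'.1 - d.1 * d'.1, d.2 * d'.2 - d.1 * d'.1) = Φ₅ d * Φ₅ d') ∧
      Φ₅ (-1, 1) = (-(UpperHalfPlane.ρ : ℂ) ^ 2) ^ e ∧
      (∀ y z : ℤ × ℤ, Ψ (y.1 + M' * z.1, y.2 + M' * z.2) = Ψ y) ∧ (∀ y : ℤ × ℤ, IsIntegral ℤ (Ψ y)) ∧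
      (∀ y : ℤ × ℤ, W y = Φ₅ ((y.2 : ZMod 5), ((y.1 + y.2 : ℤ) : ZMod 5)) * Ψ y) ∧
      Differentiable ℂ L ∧
      (∀ s : ℂ, 2 < s.re →
        L s = LSeries (fun n : ℕ ↦ χ⁻¹ (n : ZMod ℓ) * ((⟨0, 0, 0, 0, (k : ℚ)⟩ : WeierstrassCurve ℚ).LFunction n : ℂ)) s) ∧
      IsIntegral ℤ u ∧ ¬ 5 ∣ N ∧
      L 1 = u / N * BinaryTheta.thetaLFunction 3 (2 * (5 * M')) 1 (-((Real.sqrt (3 : ℕ) : ℂ) * I))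
        (QuadOrder.parityLift W) 1 := by
  obtain ⟨u₀, hu₀, hku₀⟩ := h2
  have h5ℓ : ¬ 5 ∣ ℓ := not_five_dvd_of_prime_not_dvd hℓ hℓk h5k
  have hc : ∀ a : ZMod ℓ, IsIntegral ℤ ((fun a : ZMod ℓ ↦ χ⁻¹ a) a) := fun a ↦
    ModularForms.isIntegral_dirichletCharacter_apply χ⁻¹ a
  obtain ⟨e, u₁, M', hM', _, Φ₅, Ψ, he1, he5, hu, -, -, hcop, hΦ0, hmul, hgen, -, hΨper, hΨint, -, hdict⟩ :=
    SexticTwist.lSeries_twist_eq_thetaLFunction_five_good hu₀ hku₀ h6 h5k h5ℓ (fun a : ZMod ℓ ↦ χ⁻¹ a)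
  refine ⟨e, 16 * u₁.natAbs, M', hM', Φ₅, Ψ, fun y ↦ Φ₅ ((y.2 : ZMod 5), ((y.1 + y.2 : ℤ) : ZMod 5)) * Ψ y,
    fun s ↦ (4 : ℂ) ^ s / 2 * BinaryTheta.thetaLFunction 3 (2 * (5 * M')) 1 (-((Real.sqrt (3 : ℕ) : ℂ) * I))
      (QuadOrder.parityLift fun y : ℤ × ℤ ↦ Φ₅ ((y.2 : ZMod 5), ((y.1 + y.2 : ℤ) : ZMod 5)) * Ψ y) s,
    2, 1, he1, he5, natAbs_eq_of_eq_sixteen_mul hku₀ hu, hcop, hΦ0, hmul, hgen, hΨper, hΨint hc, fun _ ↦ rfl,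
    differentiable_cpow_div_mul (BinaryTheta.differentiable_thetaLFunction 3 (2 * (5 * M')) 1 _ _), fun s hs ↦ ?_,
    by simpa using isIntegral_algebraMap (R := ℤ) (A := ℂ) (x := (2 : ℤ)), by decide, ?_⟩
  · have h := hdict s (by linarith)
    simp only
    rw [sqrt_three_natCast, ← h]
    rfl
  · simp only
    rw [Complex.cpow_one, Nat.cast_one, div_one]
    norm_num

/-- **The sextic theta dictionary over the whole range of `H₅`** (`hdictAllRho` of `…OfSexticDictionaryMulCharRho`, DISCHARGED): additive-at-`2`
classes by bed-w2 g11's `…_five` (through `dictDataRho_of_not_goodAtTwo`), the good-at-`2` class by `…_five_good` (`dictDataRho_of_goodAtTwo`).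
[cite: IrelandRosen1990, Ch. 18 §7] -/
theorem hdictAllRho_holds :
    ∀ (k : ℤ), k ≠ 0 → (5 : ℤ) ∣ k → (∀ q : ℕ, q.Prime → ¬ ((q : ℤ) ^ 6 ∣ k)) →
      ∀ (ℓ : ℕ) [NeZero ℓ], ℓ.Prime → 5 ≤ ℓ → ¬ (ℓ : ℤ) ∣ k → ¬ 4 ∣ ℓ - 1 → ¬ 5 ∣ ℓ - 1 →
        IsSquare ((5 : ℕ) : ZMod ℓ) →
      ∀ χ : DirichletCharacter ℂ ℓ, χ.Odd →
      ∃ (e k₁ M' : ℕ) (_ : NeZero M') (Φ₅ : ZMod 5 × ZMod 5 → ℂ) (Ψ W : ℤ × ℤ → ℂ) (L : ℂ → ℂ) (u : ℂ) (N : ℕ),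
        1 ≤ e ∧ e ≤ 5 ∧ k.natAbs = 5 ^ e * k₁ ∧ Nat.Coprime 5 M' ∧
        Φ₅ 0 = 0 ∧
        (∀ d d' : ZMod 5 × ZMod 5, Φ₅ (d.1 * d'.2 + d.2 * d'.1 - d.1 * d'.1, d.2 * d'.2 - d.1 * d'.1) = Φ₅ d * Φ₅ d') ∧
        Φ₅ (-1, 1) = (-(UpperHalfPlane.ρ : ℂ) ^ 2) ^ e ∧
        (∀ y z : ℤ × ℤ, Ψ (y.1 + M' * z.1, y.2 + M' * z.2) = Ψ y) ∧ (∀ y : ℤ × ℤ, IsIntegral ℤ (Ψ y)) ∧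
        (∀ y : ℤ × ℤ, W y = Φ₅ ((y.2 : ZMod 5), ((y.1 + y.2 : ℤ) : ZMod 5)) * Ψ y) ∧
        Differentiable ℂ L ∧
        (∀ s : ℂ, 2 < s.re →
          L s = LSeries (fun n : ℕ ↦ χ⁻¹ (n : ZMod ℓ) * ((⟨0, 0, 0, 0, (k : ℚ)⟩ : WeierstrassCurve ℚ).LFunction n : ℂ)) s) ∧
        IsIntegral ℤ u ∧ ¬ 5 ∣ N ∧
        L 1 = u / N * BinaryTheta.thetaLFunction 3 (2 * (5 * M')) 1 (-((Real.sqrt (3 : ℕ) : ℂ) * I))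
          (QuadOrder.parityLift W) 1 :=
  hdictAllRho_of_goodAtTwo fun k hk h5k h6 h2 ℓ _ hℓ hℓk χ ↦ dictDataRho_of_goodAtTwo k hk h5k h6 h2 ℓ hℓ hℓk χ

/-- ★★ **`ManinDatumSupercuspidalCMInert`** (crux stmt-BirchSwinnertonDyer-20111 of route `BiquadraticEisensteinDescent`), UNCONDITIONALLY: for a CM
elliptic curve `W/ℚ` (globally minimal model) of analytic rank `1`, `p ∈ {5, 7}` inert in the CM field and bad for `W`, the place `v ∣ p`, and a
lattice-optimal `X₀(N_W)`-parametrisation datum `D`: on the supercuspidal cells (`p = 5`, `j = 0`, Kodaira `II/IV/IV*/II*`) ∪ (`p = 7`, `j = 1728`,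
Kodaira `III/III*`), `p ∤ c(D)`. [cite: Manin1972, Thm. 1.6] [cite: Edixhoven1991, Thm. 3] [cite: Rubin1999, §7.4 Prop. 7.15] [cite: IrelandRosen1990, Ch. 18 §7] -/
theorem maninDatumSupercuspidalCMInert_holds : ManinDatumSupercuspidalCMInert :=
  maninDatumSupercuspidalCMInert_of_goodAtTwoDictionary fun k hk h5k h6 h2 ℓ _ hℓ hℓk χ ↦
    dictDataRho_of_goodAtTwo k hk h5k h6 h2 ℓ hℓ hℓk χ

end Summit.BirchSwinnertonDyer.BirchSwinnertonDyer.Theorems.BiquadraticEisensteinDescentManinDatumSupercuspidalCMInertSexticDictionaryHolds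

end
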